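import Literature.MathematicalPhysics.QuantumFieldTheory.SchwingerLimitInheritance
import Literature.MathematicalPhysics.QuantumFieldTheory.OSData
import HarnessLib

/-!
# Soft OS closure I: limit functionals on `⁰𝒮` and inheritance of the OS axioms (labelled families)

Support file for crux `QuarksAsStableAction.StableActionBridge` (item stmt-QuantumFields-9737), line `Sketch`
(reshape r3c): the "existence of the limit Schwinger functions as tempered distributions on `⁰𝒮` + inheritance
of E0 / E0′ / E1-translations / E2 / E3 / E4 / gap along asymptotic lattice properties" half of the proved
composition `qcdOf_of_package` (file `…SoftClosureQCD`).  Everything here is generic in the label type `ι`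
and fully proved (no named fact):

* `exists_clm_tendsto_of_offDiagonal`, `exists_labelled_tendsto` — continuous linear limit functionals on `⁰𝒮`
  from a k-uniform bound + FULL-sequence convergence (linear limit on the subspace, bound in the limit,
  Hahn–Banach: tree `Literature.Analysis.FunctionSpaces.SchwartzMap.exists_linearMap_of_tendsto_on_submodule` /
  `exists_clm_extension_of_le_seminorm`);
* `hasLinearGrowth_of_labelled_bound` (E0′), `isNormalized_of_labelled_tendsto` (E0), `translate_eq_of_labelled_tendsto`
  and `translate_eq_of_labelled_tendsto_of_approx` (E1-translations from asymptotic invariance, also under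
  approximating lattice vectors via equicontinuity), `isSymmetric_of_labelled_tendsto` (E3),
  `isHermitian_of_labelled_tendsto` (E0-hermiticity), `isReflectionPositive_of_labelled_tendsto` (E2 from EVENTUAL
  APPROXIMATE positivity of the OS forms), `hasClusterProperty_of_labelled_tendsto` (E4 from k-uniform spatial
  clustering), `hasMassGap_of_labelled_tendsto` (gap from a k-uniform exponential clustering bound),
  `exists_osData_of_axioms` (packaging by `OSData.ofAxioms`).

Model: the one-field Yang–Mills toolkit `YangMills/Theorems/ParabolicTrajectoryContinuumLimitOnTrajectoryStubOSLegs{A,B,C,D}`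
and Literature `SchwingerLimitInheritance` (subsequential version).  References: Osterwalder–Schrader II (CMP 42, 1975) §2, §4;
Glimm–Jaffe 1987 §6.1; Rudin, Functional Analysis, Thms. 2.8, 3.3.
-/

noncomputable section

open Filter Topology ComplexConjugate
open scoped SchwartzMap
open Literature.MathematicalPhysics.AQFT Literature.MathematicalPhysics.QuantumLattice
open Literature.MathematicalPhysics.QuantumFieldTheory

namespace Summit.QuantumFields.QCD.Cruxes.StableActionBridge.Sketch

/-! ### The limit functionals -/

section Limit

variable {E : Type*} [NormedAddCommGroup E] [NormedSpace ℝ E]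

/-- **Limit functional of one arity.**  Continuous linear functionals `u j` on `𝓢(Eⁿ)` that are eventually
bounded by `C |F|_m` on `⁰𝒮ₙ` and converge at every `F ∈ ⁰𝒮ₙ` have a limit `v : 𝓢(Eⁿ) →L[ℂ] ℂ` on `⁰𝒮ₙ`
obeying `‖v F‖ ≤ C |F|_m` for ALL `F` (Rudin Thm. 2.8 for the linear limit on the subspace, the bound in the
limit, Hahn–Banach Thm. 3.3 for the extension). [folklore] -/
theorem exists_clm_tendsto_of_offDiagonal {n : ℕ} (u : ℕ → 𝓢((Fin n → E), ℂ) →L[ℂ] ℂ) {C : ℝ}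
    (hC : 0 ≤ C) (m : ℕ)
    (hb : ∀ᶠ j in atTop, ∀ F : 𝓢((Fin n → E), ℂ), IsOffDiagonal F → ‖u j F‖ ≤ C * schwartzNorm m F)
    (hconv : ∀ F : 𝓢((Fin n → E), ℂ), IsOffDiagonal F →
      ∃ c : ℂ, Tendsto (fun j => u j F) atTop (𝓝 c)) :
    ∃ v : 𝓢((Fin n → E), ℂ) →L[ℂ] ℂ,
      (∀ F : 𝓢((Fin n → E), ℂ), IsOffDiagonal F → Tendsto (fun j => u j F) atTop (𝓝 (v F))) ∧
      ∀ F : 𝓢((Fin n → E), ℂ), ‖v F‖ ≤ C * schwartzNorm m F := by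
  let M : Submodule ℂ 𝓢((Fin n → E), ℂ) :=
    { carrier := {F | IsOffDiagonal F}
      add_mem' := fun hF hG => hF.add hG
      zero_mem' := isOffDiagonal_zero
      smul_mem' := @fun c G hG => hG.smul c }
  have hM : ∀ F : 𝓢((Fin n → E), ℂ), F ∈ M ↔ IsOffDiagonal F := fun _ => Iff.rfl
  obtain ⟨f, hf⟩ :=
    Literature.Analysis.FunctionSpaces.SchwartzMap.exists_linearMap_of_tendsto_on_submodule M u
      fun θ hθ => hconv θ ((hM θ).1 hθ)
  have hfb : ∀ θ : M,
      ‖f θ‖ ≤ C * ((Finset.Iic (m, m)).sup (schwartzSeminormFamily ℂ (Fin n → E) ℂ)) θ :=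
    fun θ => le_of_tendsto (hf θ).norm (hb.mono fun j hj => hj θ θ.2)
  obtain ⟨v, hvf, hvb⟩ :=
    Literature.Analysis.FunctionSpaces.SchwartzMap.exists_clm_extension_of_le_seminorm M f
      (Finset.Iic (m, m)) hC hfb
  refine ⟨v, fun F hF => ?_, fun F => hvb F⟩
  have h := hf ⟨F, hF⟩
  rw [← hvf ⟨F, hF⟩] at h
  exact h

/-- **Limit family.**  For a sequence of labelled families `Λ j` (all arities `n`, all label strings `k`)
eventually bounded by `σₙ |F|_{mₙ}` on `⁰𝒮ₙ` and convergent there along the full sequence, there is ONE labelled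
family `S` of continuous linear functionals with `Λ j n k F → S n k F` for `F ∈ ⁰𝒮ₙ` and
`‖S n k F‖ ≤ σₙ |F|_{mₙ}` for all `F` (the previous theorem, arity by arity and string by string).  This is the
"existence of the limit Schwinger functions as tempered distributions on `⁰𝒮`" step of every lattice ⇒ OS
construction (Glimm–Jaffe §6.1; OS II §4). [folklore] -/
theorem exists_labelled_tendsto {ι : Type*} (Λ : ℕ → LabelledSchwingerFamily ι E) (σb : ℕ → ℝ)
    (m : ℕ → ℕ) (hσ : ∀ n, 0 ≤ σb n)
    (hb : ∀ (n : ℕ) (k : Fin n → ι), ∀ᶠ j in atTop, ∀ F : 𝓢((Fin n → E), ℂ), IsOffDiagonal F →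
      ‖Λ j n k F‖ ≤ σb n * schwartzNorm (m n) F)
    (hconv : ∀ (n : ℕ) (k : Fin n → ι) (F : 𝓢((Fin n → E), ℂ)), IsOffDiagonal F →
      ∃ c : ℂ, Tendsto (fun j => Λ j n k F) atTop (𝓝 c)) :
    ∃ S : LabelledSchwingerFamily ι E,
      (∀ (n : ℕ) (k : Fin n → ι) (F : 𝓢((Fin n → E), ℂ)), IsOffDiagonal F →
        Tendsto (fun j => Λ j n k F) atTop (𝓝 (S n k F))) ∧
      ∀ (n : ℕ) (k : Fin n → ι) (F : 𝓢((Fin n → E), ℂ)), ‖S n k F‖ ≤ σb n * schwartzNorm (m n) F := by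
  have key : ∀ (n : ℕ) (k : Fin n → ι), ∃ v : 𝓢((Fin n → E), ℂ) →L[ℂ] ℂ,
      (∀ F : 𝓢((Fin n → E), ℂ), IsOffDiagonal F → Tendsto (fun j => Λ j n k F) atTop (𝓝 (v F))) ∧
      ∀ F : 𝓢((Fin n → E), ℂ), ‖v F‖ ≤ σb n * schwartzNorm (m n) F :=
    fun n k => exists_clm_tendsto_of_offDiagonal (fun j => Λ j n k) (hσ n) (m n) (hb n k) (hconv n k)
  choose v hv hvb using key
  exact ⟨fun n k => v n k, fun n k F hF => hv n k F hF, fun n k F => hvb n k F⟩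

end Limit

/-! ### Inheritance of E0, E0′, E1 (translations), E3 along pointwise limits on `⁰𝒮` -/

section Inheritance

variable {ι : Type*} {E : Type*} [NormedAddCommGroup E] [NormedSpace ℝ E]

/-- **E0′ from a bound**: `‖S n k F‖ ≤ α (n!)^β |F|_{n s}` on `⁰𝒮` (one set of constants for all label
strings) is `HasLinearGrowth` (OS II §2). [folklore] -/
theorem hasLinearGrowth_of_labelled_bound (S : LabelledSchwingerFamily ι E) (s : ℕ) (α β : ℝ)
    (h : ∀ (n : ℕ) (k : Fin n → ι) (F : 𝓢((Fin n → E), ℂ)), IsOffDiagonal F →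
      ‖S n k F‖ ≤ α * (n.factorial : ℝ) ^ β * schwartzNorm (n * s) F) :
    S.HasLinearGrowth :=
  fun _ => ⟨s, α, β, fun n k _ F hF => h n k F hF⟩

/-- **E0 (normalisation) is inherited**: if `Λ j 0 k F → S 0 k F` and eventually `Λ j 0 k F = F()` then
`S 0 k F = F()` (`⁰𝒮₀ = 𝒮`). [folklore] -/
theorem isNormalized_of_labelled_tendsto
    {Λ : ℕ → LabelledSchwingerFamily ι E} {S : LabelledSchwingerFamily ι E}
    (hconv : ∀ (n : ℕ) (k : Fin n → ι) (F : 𝓢((Fin n → E), ℂ)), IsOffDiagonal F →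
      Tendsto (fun j => Λ j n k F) atTop (𝓝 (S n k F)))
    (h : ∀ᶠ j in atTop, (Λ j).IsNormalized) : S.IsNormalized := by
  intro k F
  refine tendsto_nhds_unique (hconv 0 k F (isOffDiagonal_of_subsingleton F)) ?_
  exact tendsto_const_nhds.congr' (h.mono fun _ hj => (hj k F).symm)

/-- **E1 (translations) from asymptotic invariance**: if `Λ j n k (F(· − a)) − Λ j n k F → 0` for every
translation `a` and every `F ∈ ⁰𝒮ₙ`, the limit is translation invariant on `⁰𝒮` (both sides converge;
`⁰𝒮` is translation stable). [folklore] -/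
theorem translate_eq_of_labelled_tendsto
    {Λ : ℕ → LabelledSchwingerFamily ι E} {S : LabelledSchwingerFamily ι E}
    (hconv : ∀ (n : ℕ) (k : Fin n → ι) (F : 𝓢((Fin n → E), ℂ)), IsOffDiagonal F →
      Tendsto (fun j => Λ j n k F) atTop (𝓝 (S n k F)))
    (h : ∀ (n : ℕ) (k : Fin n → ι) (a : E) (F : 𝓢((Fin n → E), ℂ)), IsOffDiagonal F →
      Tendsto (fun j => Λ j n k (translateMulti a F) - Λ j n k F) atTop (𝓝 0))
    (n : ℕ) (k : Fin n → ι) (a : E) (F : 𝓢((Fin n → E), ℂ)) (hF : IsOffDiagonal F) :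
    S n k (translateMulti a F) = S n k F := by
  have hA : Tendsto (fun j => Λ j n k (translateMulti a F)) atTop (𝓝 (S n k (translateMulti a F))) :=
    hconv n k _ (hF.translateMulti a)
  have hB : Tendsto (fun j => Λ j n k F) atTop (𝓝 (S n k F)) := hconv n k F hF
  have h1 : Tendsto (fun j => Λ j n k (translateMulti a F) - Λ j n k F) atTop
      (𝓝 (S n k (translateMulti a F) - S n k F)) := hA.sub hB
  have h2 : S n k (translateMulti a F) - S n k F = 0 := tendsto_nhds_unique h1 (h n k a F hF)
  exact sub_eq_zero.1 h2

/-- **E1 (translations) from asymptotic invariance under APPROXIMATING vectors** (e.g. lattice vectors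
`b j → a` at spacing `a_j → 0`), using the equicontinuity given by the uniform bound and the strong continuity
of translations on `𝓢` — the labelled form of the tree's `translateMulti_apply_eq_of_tendsto`. [folklore] -/
theorem translate_eq_of_labelled_tendsto_of_approx
    {Λ : ℕ → LabelledSchwingerFamily ι E} {S : LabelledSchwingerFamily ι E}
    (hconv : ∀ (n : ℕ) (k : Fin n → ι) (F : 𝓢((Fin n → E), ℂ)), IsOffDiagonal F →
      Tendsto (fun j => Λ j n k F) atTop (𝓝 (S n k F)))
    {σb : ℕ → ℝ} {m : ℕ → ℕ}
    (hb : ∀ (n : ℕ) (k : Fin n → ι), ∀ᶠ j in atTop, ∀ F : 𝓢((Fin n → E), ℂ), IsOffDiagonal F →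
      ‖Λ j n k F‖ ≤ σb n * schwartzNorm (m n) F)
    (h : ∀ (n : ℕ) (k : Fin n → ι) (a : E), ∃ b : ℕ → E, Tendsto b atTop (𝓝 a) ∧
      ∀ F : 𝓢((Fin n → E), ℂ), IsOffDiagonal F →
        Tendsto (fun j => Λ j n k (translateMulti (b j) F) - Λ j n k F) atTop (𝓝 0))
    (n : ℕ) (k : Fin n → ι) (a : E) (F : 𝓢((Fin n → E), ℂ)) (hF : IsOffDiagonal F) :
    S n k (translateMulti a F) = S n k F := by
  obtain ⟨b, hba, hinv⟩ := h n k a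
  -- the translates `F(· - b j) → F(· - a)` in `𝓢`, hence in the norm `|·|_m`
  have hτ : Tendsto (fun j => translateMulti (b j) F) atTop (𝓝 (translateMulti a F)) :=
    ((continuous_translateMulti F).tendsto a).comp hba
  have hqc : Continuous fun G : 𝓢((Fin n → E), ℂ) => schwartzNorm (m n) G :=
    Seminorm.continuous_finsetSup (s := Finset.Iic (m n, m n)) fun i _ =>
      (schwartz_withSeminorms ℂ (Fin n → E) ℂ).continuous_seminorm i
  have h1 : Tendsto (fun j => translateMulti a F - translateMulti (b j) F) atTop (𝓝 0) := by
    simpa using (tendsto_const_nhds (x := translateMulti a F)).sub hτ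
  have hN : Tendsto (fun j => schwartzNorm (m n) (translateMulti a F - translateMulti (b j) F))
      atTop (𝓝 0) := by
    have h2 := (hqc.tendsto 0).comp h1
    rwa [show schwartzNorm (m n) (0 : 𝓢((Fin n → E), ℂ)) = 0 from map_zero _] at h2
  -- equicontinuity: `Λ j (F(· - a)) - Λ j (F(· - b j)) → 0`
  have h3 : Tendsto (fun j => Λ j n k (translateMulti a F - translateMulti (b j) F)) atTop (𝓝 0) := by
    refine squeeze_zero_norm' ((hb n k).mono fun j hj => hj _ ((hF.translateMulti a).sub
      (hF.translateMulti (b j)))) ?_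
    simpa using hN.const_mul (σb n)
  have h4 : Tendsto (fun j => Λ j n k (translateMulti a F) - Λ j n k F) atTop (𝓝 0) := by
    have h5 := h3.add (hinv F hF)
    rw [add_zero] at h5
    refine h5.congr' (Eventually.of_forall fun j => ?_)
    simp only [map_sub]
    ring
  have hA : Tendsto (fun j => Λ j n k (translateMulti a F)) atTop (𝓝 (S n k (translateMulti a F))) :=
    hconv n k _ (hF.translateMulti a)
  have hB : Tendsto (fun j => Λ j n k F) atTop (𝓝 (S n k F)) := hconv n k F hF
  have h6 : S n k (translateMulti a F) - S n k F = 0 := tendsto_nhds_unique (hA.sub hB) h4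
  exact sub_eq_zero.1 h6

/-- **E3 (symmetry) from asymptotic symmetry**: if `Λ j n k (F ∘ π) − Λ j n (k ∘ π) F → 0` on `⁰𝒮ₙ` (for a
symmetric lattice functional this difference is identically `0`), the limit is symmetric. [folklore] -/
theorem isSymmetric_of_labelled_tendsto
    {Λ : ℕ → LabelledSchwingerFamily ι E} {S : LabelledSchwingerFamily ι E}
    (hconv : ∀ (n : ℕ) (k : Fin n → ι) (F : 𝓢((Fin n → E), ℂ)), IsOffDiagonal F →
      Tendsto (fun j => Λ j n k F) atTop (𝓝 (S n k F)))
    (h : ∀ (n : ℕ) (k : Fin n → ι) (π : Equiv.Perm (Fin n)) (F : 𝓢((Fin n → E), ℂ)), IsOffDiagonal F →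
      Tendsto (fun j => Λ j n k (permTest π F) - Λ j n (k ∘ π) F) atTop (𝓝 0)) :
    S.IsSymmetric := by
  intro n k π F hF
  have hA : Tendsto (fun j => Λ j n k (permTest π F)) atTop (𝓝 (S n k (permTest π F))) :=
    hconv n k _ (hF.permTest π)
  have hB : Tendsto (fun j => Λ j n (k ∘ π) F) atTop (𝓝 (S n (k ∘ π) F)) := hconv n (k ∘ π) F hF
  have h2 : S n k (permTest π F) - S n (k ∘ π) F = 0 := tendsto_nhds_unique (hA.sub hB) (h n k π F hF)
  exact sub_eq_zero.1 h2

end Inheritance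

/-! ### Inheritance of E0 (hermiticity), E2, E4 and the gap (time = coordinate `0`) -/

section Time

variable {ι : Type} {d : ℕ} [NeZero d]


/-- **E0 (hermiticity) from asymptotic hermiticity**: if `Λ j n k F − conj (Λ j n kʳᵉᵛ (ΘF*)) → 0` for
time-ordered `F` (identically `0` for a reflection-symmetric lattice functional), the limit is hermitian
(time-ordered `F` and `ΘF*` lie in `⁰𝒮`; conjugation is continuous). [folklore] -/
theorem isHermitian_of_labelled_tendsto
    {Λ : ℕ → LabelledSchwingerFamily ι (EuclideanSpace ℝ (Fin d))}
    {S : LabelledSchwingerFamily ι (EuclideanSpace ℝ (Fin d))}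
    (hconv : ∀ (n : ℕ) (k : Fin n → ι) (F : 𝓢((Fin n → (EuclideanSpace ℝ (Fin d))), ℂ)), IsOffDiagonal F →
      Tendsto (fun j => Λ j n k F) atTop (𝓝 (S n k F)))
    (h : ∀ (n : ℕ) (k : Fin n → ι) (F : 𝓢((Fin n → (EuclideanSpace ℝ (Fin d))), ℂ)), IsTimeOrdered F →
      Tendsto (fun j => Λ j n k F - conj (Λ j n (k ∘ Fin.rev) (osAdjoint F))) atTop (𝓝 0)) :
    S.IsHermitian := by
  intro n k F hF
  have hFo : IsOffDiagonal F := hF.isOffDiagonal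
  have hadj : Tendsto (fun j => conj (Λ j n (k ∘ Fin.rev) (osAdjoint F))) atTop
      (𝓝 (conj (S n (k ∘ Fin.rev) (osAdjoint F)))) :=
    (Complex.continuous_conj.tendsto _).comp (hconv n (k ∘ Fin.rev) (osAdjoint F) hFo.osAdjoint)
  have hA : Tendsto (fun j => Λ j n k F) atTop (𝓝 (S n k F)) := hconv n k F hFo
  have h2 : S n k F - conj (S n (k ∘ Fin.rev) (osAdjoint F)) = 0 :=
    tendsto_nhds_unique (hA.sub hadj) (h n k F hF)
  exact sub_eq_zero.1 h2

/-- **E2 (reflection positivity) from EVENTUAL APPROXIMATE positivity of the OS forms.**  If for every finite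
family of time-ordered test functions and every `ε > 0` the OS form `z_j = Σᵢⱼ Λ j (ΘFᵢ* ⊗ Fⱼ)` eventually
satisfies `re z_j ≥ −ε` and `|im z_j| ≤ ε` (exact positivity of a reflection-positive lattice functional is
the case `ε = 0`; a boundary-condition defect that vanishes in the limit is allowed), then the limit is
reflection positive: the witnesses lie in `⁰𝒮`, the finite sums converge, and the limits of `re`, `im` obey the
bounds for every `ε`. [cite: OsterwalderSchraderCMP1975, §4] -/
theorem isReflectionPositive_of_labelled_tendsto
    {Λ : ℕ → LabelledSchwingerFamily ι (EuclideanSpace ℝ (Fin d))}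
    {S : LabelledSchwingerFamily ι (EuclideanSpace ℝ (Fin d))}
    (hconv : ∀ (n : ℕ) (k : Fin n → ι) (F : 𝓢((Fin n → (EuclideanSpace ℝ (Fin d))), ℂ)), IsOffDiagonal F →
      Tendsto (fun j => Λ j n k F) atTop (𝓝 (S n k F)))
    (h : ∀ (N : ℕ) (deg : Fin N → ℕ) (lab : (j : Fin N) → Fin (deg j) → ι)
      (F : (j : Fin N) → 𝓢((Fin (deg j) → (EuclideanSpace ℝ (Fin d))), ℂ)), (∀ j, IsTimeOrdered (F j)) →
      ∀ H : (i j : Fin N) → 𝓢((Fin (deg i + deg j) → (EuclideanSpace ℝ (Fin d))), ℂ),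
        (∀ i j, IsAppendTensorOf (H i j) (osAdjoint (F i)) (F j)) →
        ∀ ε : ℝ, 0 < ε → ∀ᶠ l in atTop,
          -ε ≤ (∑ i, ∑ j, Λ l (deg i + deg j) (Fin.append (lab i ∘ Fin.rev) (lab j)) (H i j)).re ∧
          |(∑ i, ∑ j, Λ l (deg i + deg j) (Fin.append (lab i ∘ Fin.rev) (lab j)) (H i j)).im| ≤ ε) :
    S.IsReflectionPositive := by
  intro N deg lab F hF H hH
  dsimp only
  set z : ℂ := ∑ i, ∑ j, S (deg i + deg j) (Fin.append (lab i ∘ Fin.rev) (lab j)) (H i j) with hz_def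
  have hz : Tendsto (fun l => ∑ i, ∑ j, Λ l (deg i + deg j) (Fin.append (lab i ∘ Fin.rev) (lab j)) (H i j))
      atTop (𝓝 z) := by
    refine tendsto_finsetSum _ fun i _ => tendsto_finsetSum _ fun j _ => ?_
    exact hconv _ _ (H i j) ((hH i j).isOffDiagonal_of_isTimeOrdered (hF i) (hF j))
  have hre := (Complex.continuous_re.tendsto _).comp hz
  have him := (Complex.continuous_im.tendsto _).comp hz
  have hre' : ∀ ε : ℝ, 0 < ε → -ε ≤ z.re := fun ε hε =>
    ge_of_tendsto hre ((h N deg lab F hF H hH ε hε).mono fun _ hl => hl.1)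
  have him' : ∀ ε : ℝ, 0 < ε → |z.im| ≤ ε := fun ε hε =>
    le_of_tendsto ((continuous_abs.tendsto _).comp him) ((h N deg lab F hF H hH ε hε).mono fun _ hl => hl.2)
  refine ⟨?_, ?_⟩
  · by_contra hneg
    push Not at hneg
    have := hre' (-z.re / 2) (by linarith)
    linarith
  · have h0 : |z.im| ≤ 0 := le_of_forall_pos_le_add fun ε hε => by simpa using him' ε hε
    exact abs_nonpos_iff.1 h0

/-- **E4 (cluster property) from clustering that is uniform along the sequence.**  If for all time-ordered
`F, G`, every purely spatial `a ≠ 0` and every `ε > 0` there is `t₀` such that for all `t ≥ t₀` the lattice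
truncated function `Λ j (ΘF* ⊗ G(· − t a)) − Λ j (ΘF*) Λ j (G)` is eventually (in `j`) bounded by `ε`, then
the limit clusters (each witness lies in `⁰𝒮` — spatial translations preserve time-ordering — and norm bounds
pass to the limit). [cite: OsterwalderSchraderCMP1973, §3 (E4)] -/
theorem hasClusterProperty_of_labelled_tendsto
    {Λ : ℕ → LabelledSchwingerFamily ι (EuclideanSpace ℝ (Fin d))}
    {S : LabelledSchwingerFamily ι (EuclideanSpace ℝ (Fin d))}
    (hconv : ∀ (n : ℕ) (k : Fin n → ι) (F : 𝓢((Fin n → (EuclideanSpace ℝ (Fin d))), ℂ)), IsOffDiagonal F →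
      Tendsto (fun j => Λ j n k F) atTop (𝓝 (S n k F)))
    (h : ∀ (n m : ℕ) (k : Fin n → ι) (k' : Fin m → ι) (F : 𝓢((Fin n → (EuclideanSpace ℝ (Fin d))), ℂ)) (G : 𝓢((Fin m → (EuclideanSpace ℝ (Fin d))), ℂ)),
      IsTimeOrdered F → IsTimeOrdered G → ∀ a : (EuclideanSpace ℝ (Fin d)), a 0 = 0 → a ≠ 0 → ∀ ε : ℝ, 0 < ε →
        ∃ t₀ : ℝ, ∀ t : ℝ, t₀ ≤ t → ∀ H : 𝓢((Fin (n + m) → (EuclideanSpace ℝ (Fin d))), ℂ),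
          IsAppendTensorOf H (osAdjoint F) (translateMulti (t • a) G) →
          ∀ᶠ j in atTop, ‖Λ j (n + m) (Fin.append (k ∘ Fin.rev) k') H -
            Λ j n (k ∘ Fin.rev) (osAdjoint F) * Λ j m k' G‖ ≤ ε) :
    S.HasClusterProperty := by
  intro n m k k' F G hF hG a ha0 ha H hH
  rw [Metric.tendsto_nhds]
  intro ε hε
  obtain ⟨t₀, ht₀⟩ := h n m k k' F G hF hG a ha0 ha (ε / 2) (half_pos hε)
  refine (eventually_ge_atTop t₀).mono fun t ht => ?_
  have hGt : IsTimeOrdered (translateMulti (t • a) G) :=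
    OSReconstructionNoE1.isTimeOrdered_translateMulti hG (by simp [ha0])
  have hHo : IsOffDiagonal (H t) := (hH t).isOffDiagonal_of_isTimeOrdered hF hGt
  have hlim : Tendsto (fun j => Λ j (n + m) (Fin.append (k ∘ Fin.rev) k') (H t) -
      Λ j n (k ∘ Fin.rev) (osAdjoint F) * Λ j m k' G) atTop
      (𝓝 (S (n + m) (Fin.append (k ∘ Fin.rev) k') (H t) - S n (k ∘ Fin.rev) (osAdjoint F) * S m k' G)) :=
    (hconv _ _ _ hHo).sub ((hconv _ _ _ hF.isOffDiagonal.osAdjoint).mul (hconv _ _ _ hG.isOffDiagonal))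
  have hle : ‖S (n + m) (Fin.append (k ∘ Fin.rev) k') (H t) - S n (k ∘ Fin.rev) (osAdjoint F) * S m k' G‖
      ≤ ε / 2 :=
    le_of_tendsto hlim.norm (ht₀ t ht (H t) (hH t))
  rw [dist_zero_right]
  linarith

/-- **The full-spectrum gap from an exponential clustering bound uniform along the sequence.**  If for all
time-ordered `F, G` there is `C` with `‖Λ j (ΘF* ⊗ G(· − t e₀)) − Λ j (ΘF*) Λ j (G)‖ ≤ C e^{−Δt}` eventually in
`j`, for every `t ≥ 0` and every witness, then `S.HasMassGap Δ`. [cite: GlimmJaffeQP1987, §6.1 Thm. 6.1.3] -/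
theorem hasMassGap_of_labelled_tendsto
    {Λ : ℕ → LabelledSchwingerFamily ι (EuclideanSpace ℝ (Fin d))}
    {S : LabelledSchwingerFamily ι (EuclideanSpace ℝ (Fin d))}
    (hconv : ∀ (n : ℕ) (k : Fin n → ι) (F : 𝓢((Fin n → (EuclideanSpace ℝ (Fin d))), ℂ)), IsOffDiagonal F →
      Tendsto (fun j => Λ j n k F) atTop (𝓝 (S n k F)))
    {Δ : ℝ}
    (h : ∀ (n m : ℕ) (k : Fin n → ι) (k' : Fin m → ι) (F : 𝓢((Fin n → (EuclideanSpace ℝ (Fin d))), ℂ)) (G : 𝓢((Fin m → (EuclideanSpace ℝ (Fin d))), ℂ)),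
      IsTimeOrdered F → IsTimeOrdered G → ∃ C : ℝ, ∀ t : ℝ, 0 ≤ t →
        ∀ H : 𝓢((Fin (n + m) → (EuclideanSpace ℝ (Fin d))), ℂ),
          IsAppendTensorOf H (osAdjoint F) (translateMulti (EuclideanSpace.single 0 t) G) →
          ∀ᶠ j in atTop, ‖Λ j (n + m) (Fin.append (k ∘ Fin.rev) k') H -
            Λ j n (k ∘ Fin.rev) (osAdjoint F) * Λ j m k' G‖ ≤ C * Real.exp (-Δ * t)) :
    S.HasMassGap Δ := by
  intro n m k k' F G hF hG
  obtain ⟨C, hC⟩ := h n m k k' F G hF hG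
  refine ⟨C, fun t ht H hH => ?_⟩
  have hGt : IsTimeOrdered (translateMulti (EuclideanSpace.single 0 t) G) :=
    OSReconstructionNoE1.isTimeOrdered_translateMulti hG (by simpa using ht)
  have hHo : IsOffDiagonal H := hH.isOffDiagonal_of_isTimeOrdered hF hGt
  have hlim : Tendsto (fun j => Λ j (n + m) (Fin.append (k ∘ Fin.rev) k') H -
      Λ j n (k ∘ Fin.rev) (osAdjoint F) * Λ j m k' G) atTop
      (𝓝 (S (n + m) (Fin.append (k ∘ Fin.rev) k') H - S n (k ∘ Fin.rev) (osAdjoint F) * S m k' G)) :=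
    (hconv _ _ _ hHo).sub ((hconv _ _ _ hF.isOffDiagonal.osAdjoint).mul (hconv _ _ _ hG.isOffDiagonal))
  exact le_of_tendsto hlim.norm (hC t ht H hH)

/-- **Packaging into OS data.**  A labelled family with E0 (normalisation, hermiticity), E0′, translation
invariance and proper-rotation invariance on `⁰𝒮` (the two halves of E1), E2, E3 and E4 is `OSData`
(`OSData.ofAxioms`), with unchanged Schwinger functions. [cite: OsterwalderSchraderCMP1975, §2] -/
theorem exists_osData_of_axioms :
    ∀ {ι : Type} {d : ℕ} [NeZero d] (S : LabelledSchwingerFamily ι (EuclideanSpace ℝ (Fin d))),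
      S.IsNormalized → S.IsHermitian → S.HasLinearGrowth →
      (∀ (n : ℕ) (k : Fin n → ι) (a : EuclideanSpace ℝ (Fin d)) (F : 𝓢((Fin n → EuclideanSpace ℝ (Fin d)), ℂ)),
        IsOffDiagonal F → S n k (translateMulti a F) = S n k F) →
      (∀ (n : ℕ) (k : Fin n → ι) (R : EuclideanSpace ℝ (Fin d) ≃ₗᵢ[ℝ] EuclideanSpace ℝ (Fin d)),
        LinearMap.det (R.toLinearEquiv : EuclideanSpace ℝ (Fin d) →ₗ[ℝ] EuclideanSpace ℝ (Fin d)) = 1 →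
          ∀ F : 𝓢((Fin n → EuclideanSpace ℝ (Fin d)), ℂ), IsOffDiagonal F → S n k (linActMulti R F) = S n k F) →
      S.IsReflectionPositive → S.IsSymmetric → S.HasClusterProperty → ∃ T : OSData ι d, T.schwinger = S :=
  fun S hnorm hherm hgrowth htrans hrot hrp hsymm hcl =>
  ⟨OSData.ofAxioms S
    { normalized := hnorm
      hermitian := hherm
      invariant := ⟨htrans, hrot⟩
      reflectionPositive := hrp
      symmetric := hsymm
      cluster := hcl
      linearGrowth := hgrowth }, rfl⟩

end Time

end Summit.QuantumFields.QCD.Cruxes.StableActionBridge.Sketch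

end
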